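import Mathlib.Combinatorics.Enumerative.IncidenceAlgebra
import Mathlib.Order.Partition.Finpartition
import Literature.NumberTheory.LFunctions.RudnickSarnak
import HarnessLib

/-!
# Rudnick–Sarnak §4: combinatorial sieving of correlation sums over set partitions

Z. Rudnick, P. Sarnak, *Zeros of principal `L`-functions and random matrix theory*, Duke Math.
J. **81** (1996), §4 "Combinatorial sieving", (4.2)–(4.9) (pp. 304–305). The `n`-level
correlation sum `R_n` runs over *distinct* indices, the sums `C_n` controlled by Theorem 3.2
over *all* index tuples; RS recover the former from the latter by Möbius inversion over the
lattice `Π_n` of set partitions of `{1, …, n}`: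

* (4.5) `R_F(f, T) = ∑_{i_1,…,i_ν distinct} f(ι_F(γ̃_{i_1}, …, γ̃_{i_ν}))`, the sum over tuples whose
  pattern of coincidences is exactly the set partition `F` (`ν = ν(F)` blocks);
* (4.6) `C_F(f, T) = ∑_{i_1,…,i_ν} f(ι_F(γ̃_{i_1}, …, γ̃_{i_ν}))`, coincidences along `F` allowed;
* (4.7)/(4.8) `C_G = ∑_{F ≥ G} R_F` ("merely partitioning the unrestricted sum … over the various
  possibilities for coincidences between the indices");
* (4.9) `R_O = ∑_F μ(O, F) C_F`, with `μ` the Möbius function of `Π_n` ((4.2)–(4.3)).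

This file formalises (4.5)–(4.9) for finite sums, generically in a weight
`G : (Fin n → ι) → R` on index tuples (`ι` a finite index type, e.g. `Fin N`): the kernel
partition `kerPart u` of a tuple `u` (blocks = level sets), `P ≤ kerPart u ↔ u` is constant on the
blocks of `P` (`le_kerPart_iff`), `kerPart u = ⊥ ↔ u` injective (`kerPart_eq_bot_iff`), and the
sieving identity `sum_embedding_eq_sum_partitionMoebius`:
`∑_{u injective} G(u) = ∑_{Q ∈ Π_n} μ(O, Q) ∑_{w : blocks of Q → ι} G(w ∘ block)`,
proved by Möbius inversion in the incidence algebra of `Π_n` (Mathlib's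
`IncidenceAlgebra.moebius_inversion_top`). Specialised to the zeros of `ζ`
(`levelCorrelationSum_eq_sum_partitionMoebius`):
`levelCorrelationSum n f N = ∑_Q μ(O, Q) · unrestrictedLevelSum ν(Q) (f ∘ ι_Q^*) N` with
`ι_Q^* f (z) = f(z ∘ blockIdx Q)` (RS (4.6): `C_F(f, T) = C_ν(ι_F f, T)`), which is the form in
which Theorem 3.2 (`RSUnrestrictedLimits`, `RudnickSarnak.lean`) is applied at every level
`ν(F)` in the proof of `rudnick_sarnak_sieving`.

The Möbius function is Mathlib's `IncidenceAlgebra.mu` of the refinement order on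
`Finpartition univ` (Mathlib: `P ≤ Q` iff `P` refines `Q`; `⊥` = discrete partition `O`,
`⊤` = one block), packaged as `partitionMoebius Q = μ(O, Q) ∈ ℤ`. Its closed form
`μ(O, F) = ∏_j (−1)^{|F_j|−1} (|F_j|−1)!` (RS (4.4); Stanley, *Enumerative Combinatorics* I,
Ex. 3.10.4) is not needed for the sieving identity and is not proved here.

## Main definitions and results

* `RudnickSarnak.finpartitionLocallyFiniteOrder`, `RudnickSarnak.partitionMoebius`,
  `RudnickSarnak.partitionMoebius_eq_prod` (RS (4.4), named fact, unused here).
* `RudnickSarnak.intCast_mu`: `IncidenceAlgebra.mu` is compatible with `ℤ → R`.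
* `RudnickSarnak.kerPart`, `mem_part_kerPart`, `le_kerPart_iff`, `kerPart_eq_bot_iff`.
* `RudnickSarnak.ofBlocks`, `RudnickSarnak.blockIdx`, `blockIdx_surjective`,
  `blockIdx_eq_blockIdx_iff`.
* `RudnickSarnak.sum_filter_le_kerPart_eq` ((4.7)/(4.8)),
  `RudnickSarnak.sum_embedding_eq_sum_partitionMoebius` ((4.9)),
  `RudnickSarnak.levelCorrelationSum_eq_sum_partitionMoebius` ((4.9) with (4.6) for `ζ`).

## References

* Z. Rudnick, P. Sarnak, Duke Math. J. 81 (1996), 269–322, §4, (4.2)–(4.9).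
* G.-C. Rota, *On the foundations of combinatorial theory I. Theory of Möbius functions*,
  Z. Wahrsch. 2 (1964) (RS ref. [25]); R. P. Stanley, *Enumerative Combinatorics* I, §3.7, 3.10.
-/

noncomputable section

open Finset

namespace Literature.NumberTheory.LFunctions

namespace RudnickSarnak

variable {n : ℕ}

/-! ## The lattice `Π_n` of set partitions and its Möbius function -/

/-- The (classical) locally finite order structure on the finite poset `Π_n` of set partitions of
`{0, …, n-1}` (`Finpartition univ`, ordered by refinement), needed to speak of its incidence
algebra. A `def`, not an instance. [cite: RudnickSarnak1996, (4.2)] -/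
@[reducible] def finpartitionLocallyFiniteOrder (n : ℕ) :
    LocallyFiniteOrder (Finpartition (univ : Finset (Fin n))) := by
  classical exact Fintype.toLocallyFiniteOrder

/-- RS (4.2)–(4.3): the Möbius function `μ(O, Q)` of the lattice `Π_n` of set partitions, from the
discrete partition `O = ⊥` to `Q` — Mathlib's `IncidenceAlgebra.mu` (the inverse of the zeta
function, `mu * zeta = 1`) for the refinement order, as an integer. Its closed form is
`∏_{t ∈ Q.parts} (−1)^{#t−1} (#t−1)!` (RS (4.4), not proved here).
[cite: RudnickSarnak1996, (4.3)] -/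
def partitionMoebius (Q : Finpartition (univ : Finset (Fin n))) : ℤ :=
  letI := finpartitionLocallyFiniteOrder n
  IncidenceAlgebra.mu ℤ (⊥ : Finpartition (univ : Finset (Fin n))) Q

/-- `μ(O, O) = 1`. [cite: RudnickSarnak1996, (4.3)] -/
theorem partitionMoebius_bot : partitionMoebius (⊥ : Finpartition (univ : Finset (Fin n))) = 1 := by
  letI := finpartitionLocallyFiniteOrder n
  unfold partitionMoebius
  exact IncidenceAlgebra.mu_self _

/-- **RS (4.4)** NAMED FACT (the Möbius function of the partition lattice; Rudnick–Sarnak 1996,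
(4.4): "In the case of `Π_n`, the Möbius function can be computed explicitly [15, 25], in
particular, `μ(O, F) = ∏_{j=1}^{k} (−1)^{|F_j|−1} (|F_j|−1)!`"; classical: Rota 1964, Stanley,
*Enumerative Combinatorics* I, Ex. 3.10.4). Here `#t ≥ 1` for every block `t` (blocks are
nonempty), so the natural-number subtraction `#t - 1` is harmless. Not needed for the sieving
identity below; recorded for completeness. Users take `(h : partitionMoebius_eq_prod)`.
[cite: RudnickSarnak1996, (4.4)] -/
def partitionMoebius_eq_prod : Prop :=
  ∀ {n : ℕ} (Q : Finpartition (univ : Finset (Fin n))),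
    partitionMoebius Q = ∏ t ∈ Q.parts, (-1) ^ (#t - 1) * ((#t - 1).factorial : ℤ)

/-- The Möbius function of a locally finite poset does not depend on the coefficient ring: the
integer-valued `μ` maps to `μ` over any ring `R` (both satisfy the defining recursion
`μ(a, b) = −∑_{a ≤ x < b} μ(a, x)`, `μ(a, a) = 1`). [folklore] -/
theorem intCast_mu {α : Type*} [PartialOrder α] [LocallyFiniteOrder α] [DecidableEq α]
    {R : Type*} [Ring R] (a b : α) :
    ((IncidenceAlgebra.mu ℤ a b : ℤ) : R) = IncidenceAlgebra.mu R a b := by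
  induction hN : (Finset.Icc a b).card using Nat.strong_induction_on generalizing b with
  | _ N ih =>
    rw [IncidenceAlgebra.mu_apply, IncidenceAlgebra.mu_apply (𝕜 := R)]
    split_ifs with hab
    · simp
    · push_cast
      congr 1
      refine Finset.sum_congr rfl fun x hx ↦ ih _ ?_ x rfl
      rw [← hN]
      apply Finset.card_lt_card
      rw [Finset.mem_Ico] at hx
      refine ⟨Finset.Icc_subset_Icc_right hx.2.le, fun h ↦ ?_⟩
      have hb : b ∈ Finset.Icc a x := h (Finset.mem_Icc.2 ⟨hx.1.trans hx.2.le, le_rfl⟩)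
      exact (Finset.mem_Icc.1 hb).2.not_gt hx.2

/-! ## Kernel partitions of index tuples -/

variable {ι : Type*}

/-- The kernel partition of a tuple `u : Fin n → ι`: the set partition of `{0, …, n-1}` into
the nonempty level sets of `u` (the "possibilities for coincidences between the indices",
RS p. 305). [cite: RudnickSarnak1996, (4.7)] -/
def kerPart (u : Fin n → ι) : Finpartition (univ : Finset (Fin n)) := by
  classical exact Finpartition.ofSetoid (Setoid.ker u)

/-- `b` lies in the block of `a` in the kernel partition of `u` iff `u a = u b`. [folklore] -/
theorem mem_part_kerPart {u : Fin n → ι} {a b : Fin n} : b ∈ (kerPart u).part a ↔ u a = u b := by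
  classical
  unfold kerPart
  rw [Finpartition.mem_part_ofSetoid_iff_rel]
  exact Setoid.ker_def

/-- RS (4.5)/(4.6): `P ≤ kerPart u` (the kernel partition is coarser than `P`) iff `u` is
constant on every block of `P` ("the indices `i_l`, `i_k` are equal if `l, k ∈ F_j`").
[cite: RudnickSarnak1996, (4.5)] -/
theorem le_kerPart_iff {P : Finpartition (univ : Finset (Fin n))} {u : Fin n → ι} :
    P ≤ kerPart u ↔ ∀ t ∈ P.parts, ∀ a ∈ t, ∀ b ∈ t, u a = u b := by
  constructor
  · intro h t ht a ha b hb
    obtain ⟨c, hc, htc⟩ := h ht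
    have hca : (kerPart u).part a = c := (kerPart u).part_eq_of_mem hc (htc ha)
    have hbc : b ∈ (kerPart u).part a := hca ▸ htc hb
    exact mem_part_kerPart.1 hbc
  · intro h t ht
    obtain ⟨a, ha⟩ := P.nonempty_of_mem_parts ht
    exact ⟨(kerPart u).part a, (kerPart u).part_mem.2 (mem_univ a),
      fun b hb ↦ mem_part_kerPart.2 (h t ht a ha b hb)⟩

/-- The blocks of the discrete partition `O = ⊥` are the singletons. [folklore] -/
theorem part_bot_eq (a : Fin n) : (⊥ : Finpartition (univ : Finset (Fin n))).part a = {a} :=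
  (⊥ : Finpartition (univ : Finset (Fin n))).part_eq_of_mem
    (Finpartition.mem_bot_iff.2 ⟨a, mem_univ a, rfl⟩) (mem_singleton_self a)

/-- RS (4.5) at `F = O`: the kernel partition of `u` is the discrete partition iff `u` is
injective (all indices distinct). [cite: RudnickSarnak1996, (4.5)] -/
theorem kerPart_eq_bot_iff {u : Fin n → ι} : kerPart u = ⊥ ↔ Function.Injective u := by
  constructor
  · intro h a b hab
    have hb : b ∈ (kerPart u).part a := mem_part_kerPart.2 hab
    rw [h, part_bot_eq] at hb
    exact (mem_singleton.1 hb).symm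
  · intro hinj
    refine le_antisymm (fun t ht ↦ ?_) bot_le
    obtain ⟨a, ha⟩ := (kerPart u).nonempty_of_mem_parts ht
    refine ⟨{a}, Finpartition.mem_bot_iff.2 ⟨a, mem_univ a, rfl⟩, fun b hb ↦ ?_⟩
    have hta : (kerPart u).part a = t := (kerPart u).part_eq_of_mem ht ha
    have hb' : b ∈ (kerPart u).part a := hta ▸ hb
    rw [mem_singleton]
    exact (hinj (mem_part_kerPart.1 hb')).symm

/-! ## Tuples constant on blocks -/

/-- The tuple `ι_Q(w)` attached to a function `w` on the blocks of `Q`: index `a` receives the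
value of `w` at the block of `a` (RS (4.5): `ι_F(x_1, …, x_ν) = (y_1, …, y_n)`, `y_i = x_j` if
`i ∈ F_j`). [cite: RudnickSarnak1996, (4.5)] -/
def ofBlocks (Q : Finpartition (univ : Finset (Fin n))) (w : Q.parts → ι) : Fin n → ι :=
  fun a ↦ w ⟨Q.part a, Q.part_mem.2 (mem_univ a)⟩

/-- The block-index map of `Q`: `a ↦` the number (in a fixed enumeration `Q.parts ≃ Fin ν(Q)`)
of the block containing `a`; a surjection `Fin n → Fin ν(Q)` with fibres the blocks of `Q`
(RS: `ι_F : ℝ^ν → ℝⁿ` is `x ↦ x ∘ blockIdx`). [cite: RudnickSarnak1996, (4.5)] -/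
def blockIdx (Q : Finpartition (univ : Finset (Fin n))) (a : Fin n) : Fin (#Q.parts) :=
  Q.parts.equivFin ⟨Q.part a, Q.part_mem.2 (mem_univ a)⟩

/-- Two indices have the same block number iff they lie in the same block. [folklore] -/
theorem blockIdx_eq_blockIdx_iff {Q : Finpartition (univ : Finset (Fin n))} {a b : Fin n} :
    blockIdx Q a = blockIdx Q b ↔ Q.part a = Q.part b := by
  unfold blockIdx
  rw [Equiv.apply_eq_iff_eq, Subtype.mk.injEq]

/-- The block-index map is surjective (every block is nonempty). [folklore] -/
theorem blockIdx_surjective (Q : Finpartition (univ : Finset (Fin n))) :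
    Function.Surjective (blockIdx Q) := by
  intro c
  obtain ⟨a, ha⟩ := Q.nonempty_of_mem_parts (Q.parts.equivFin.symm c).2
  refine ⟨a, ?_⟩
  unfold blockIdx
  rw [Equiv.apply_eq_iff_eq_symm_apply]
  exact Subtype.ext (Q.part_eq_of_mem (Q.parts.equivFin.symm c).2 ha)

/-- `ofBlocks` in terms of `blockIdx`: `ι_Q(w) = (w ∘ e⁻¹) ∘ blockIdx Q` for the enumeration
`e : Q.parts ≃ Fin ν(Q)`. [folklore] -/
theorem ofBlocks_eq_comp_blockIdx (Q : Finpartition (univ : Finset (Fin n))) (w : Q.parts → ι) :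
    ofBlocks Q w = fun a ↦ w (Q.parts.equivFin.symm (blockIdx Q a)) := by
  funext a
  simp [ofBlocks, blockIdx]

/-! ## (4.7)–(4.9): Möbius sieving -/

/-- RS (4.7)/(4.8): the sum over tuples constant on the blocks of `P` splits according to the
exact kernel partition: `C_P = ∑_{Q ≥ P} R_Q`. [cite: RudnickSarnak1996, (4.8)] -/
theorem sum_filter_le_kerPart_eq [Fintype ι] [DecidableEq ι] {M : Type*} [AddCommMonoid M]
    [DecidableEq (Finpartition (univ : Finset (Fin n)))]
    [DecidableRel (α := Finpartition (univ : Finset (Fin n))) (· ≤ ·)]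
    [LocallyFiniteOrderTop (Finpartition (univ : Finset (Fin n)))]
    (G : (Fin n → ι) → M) (P : Finpartition (univ : Finset (Fin n))) :
    ∑ u ∈ (univ : Finset (Fin n → ι)).filter (fun u ↦ P ≤ kerPart u), G u =
      ∑ Q ∈ Ici P, ∑ u ∈ (univ : Finset (Fin n → ι)).filter (fun u ↦ kerPart u = Q), G u := by
  rw [← Finset.sum_fiberwise_of_maps_to (g := fun u : Fin n → ι ↦ kerPart u) (t := Ici P)
    (fun u hu ↦ mem_Ici.2 (mem_filter.1 hu).2)]
  refine Finset.sum_congr rfl fun Q hQ ↦ Finset.sum_congr ?_ fun _ _ ↦ rfl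
  ext u
  simp only [mem_filter, mem_univ, true_and]
  exact ⟨fun h ↦ h.2, fun h ↦ ⟨h ▸ mem_Ici.1 hQ, h⟩⟩

/-- **RS (4.9), Möbius sieving.** For any weight `G` on index tuples `Fin n → ι` with values in
a commutative ring: `∑_{u injective} G(u) = ∑_{Q ∈ Π_n} μ(O, Q) · ∑_{w : Q.parts → ι} G(ι_Q w)`,
i.e. `R_O = ∑_F μ(O, F) C_F` with `R_O` the sum over distinct indices and `C_F` the unrestricted
sum over tuples constant on the blocks of `F` (parametrised by functions on the blocks). Proof:
(4.8) and Möbius inversion in the incidence algebra of `Π_n`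
(`IncidenceAlgebra.moebius_inversion_top`). [cite: RudnickSarnak1996, (4.9)] -/
theorem sum_embedding_eq_sum_partitionMoebius [Fintype ι] [DecidableEq ι] {R : Type*}
    [CommRing R] (G : (Fin n → ι) → R) :
    ∑ e : Fin n ↪ ι, G e = ∑ Q : Finpartition (univ : Finset (Fin n)),
      (partitionMoebius Q : R) * ∑ w : Q.parts → ι, G (ofBlocks Q w) := by
  classical
  letI := finpartitionLocallyFiniteOrder n
  set Rf : Finpartition (univ : Finset (Fin n)) → R :=
    fun Q ↦ ∑ u ∈ (univ : Finset (Fin n → ι)).filter (fun u ↦ kerPart u = Q), G u with hRf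
  set Cf : Finpartition (univ : Finset (Fin n)) → R :=
    fun P ↦ ∑ u ∈ (univ : Finset (Fin n → ι)).filter (fun u ↦ P ≤ kerPart u), G u with hCf
  have h48 : ∀ P, Cf P = ∑ Q ∈ Ici P, Rf Q := fun P ↦ sum_filter_le_kerPart_eq G P
  have hinv := IncidenceAlgebra.moebius_inversion_top Rf Cf h48 ⊥
  -- the left side is `R_O`
  have hL : ∑ e : Fin n ↪ ι, G e = Rf ⊥ := by
    simp only [hRf]
    refine Finset.sum_bij (fun e _ ↦ ⇑e) ?_ ?_ ?_ ?_
    · intro e _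
      simp only [mem_filter, mem_univ, true_and]
      exact kerPart_eq_bot_iff.2 e.injective
    · intro e₁ _ e₂ _ h
      exact DFunLike.coe_injective h
    · intro u hu
      simp only [mem_filter, mem_univ, true_and] at hu
      exact ⟨⟨u, kerPart_eq_bot_iff.1 hu⟩, mem_univ _, rfl⟩
    · intro e _
      rfl
  -- `C_Q` as a sum over functions on the blocks
  have hC : ∀ Q, Cf Q = ∑ w : Q.parts → ι, G (ofBlocks Q w) := by
    intro Q
    simp only [hCf]
    symm
    refine Finset.sum_bij (fun w _ ↦ ofBlocks Q w) ?_ ?_ ?_ ?_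
    · intro w _
      simp only [mem_filter, mem_univ, true_and]
      rw [le_kerPart_iff]
      intro t ht a ha b hb
      simp only [ofBlocks, Q.part_eq_of_mem ht ha, Q.part_eq_of_mem ht hb]
    · intro w₁ _ w₂ _ h
      funext ⟨t, ht⟩
      obtain ⟨a, ha⟩ := Q.nonempty_of_mem_parts ht
      have h1 := congrFun h a
      have hta : Q.part a = t := Q.part_eq_of_mem ht ha
      simp only [ofBlocks, hta] at h1
      exact h1
    · intro u hu
      simp only [mem_filter, mem_univ, true_and] at hu
      refine ⟨fun t ↦ u (Q.nonempty_of_mem_parts t.2).choose, mem_univ _, ?_⟩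
      funext a
      simp only [ofBlocks]
      have hpa : Q.part a ∈ Q.parts := Q.part_mem.2 (mem_univ a)
      have hmem := (Q.nonempty_of_mem_parts hpa).choose_spec
      exact (le_kerPart_iff.1 hu _ hpa _ hmem _ (Q.mem_part_self.2 (mem_univ a)))
    · intro w _
      rfl
  rw [hL, hinv, Finset.Ici_bot]
  refine Finset.sum_congr rfl fun Q _ ↦ ?_
  rw [hC Q]
  congr 1
  unfold partitionMoebius
  exact (intCast_mu _ _).symm

/-- **RS (4.9) with (4.6) for the zeros of `ζ`.** The `n`-level correlation sum over distinct
indices among the first `N` normalised ordinates is the Möbius-sieved combination of the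
unrestricted sums (RS's `C_F(f, T) = C_ν(ι_F f, T)`, (4.6)) at the levels `ν(Q) = #Q.parts`:
`levelCorrelationSum n f N = ∑_{Q ∈ Π_n} μ(O, Q) · unrestrictedLevelSum ν(Q) (z ↦ f(z ∘ blockIdx Q)) N`.
[cite: RudnickSarnak1996, (4.9)] -/
theorem levelCorrelationSum_eq_sum_partitionMoebius (n : ℕ) (f : (Fin n → ℝ) → ℂ) (N : ℕ) :
    levelCorrelationSum n f N = ∑ Q : Finpartition (univ : Finset (Fin n)),
      (partitionMoebius Q : ℂ) *
        unrestrictedLevelSum (#Q.parts) (fun z ↦ f (fun a ↦ z (blockIdx Q a))) N := by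
  unfold levelCorrelationSum
  rw [sum_embedding_eq_sum_partitionMoebius
    (G := fun u : Fin n → Fin N ↦ f (fun a ↦ normalizedOrdinate (u a)))]
  refine Finset.sum_congr rfl fun Q _ ↦ ?_
  congr 1
  unfold unrestrictedLevelSum
  refine Fintype.sum_equiv (Equiv.arrowCongr Q.parts.equivFin (Equiv.refl (Fin N))) _ _
    fun w ↦ ?_
  simp [ofBlocks_eq_comp_blockIdx, Equiv.arrowCongr_apply]

end RudnickSarnak

end Literature.NumberTheory.LFunctions

end
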